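import Summits.KontsevichZagierPeriods.KontsevichZagierPeriods.Theorems.UnfoldedStokesStokesGenerationFibrewiseRungAngSwap
import Summits.KontsevichZagierPeriods.KontsevichZagierPeriods.Theorems.UnfoldedStokesStokesGenerationFibrewiseRungSeparated
import Summits.KontsevichZagierPeriods.KontsevichZagierPeriods.Theorems.UnfoldedStokesStokesGenerationFibrewiseClosureCongr
import Summits.KontsevichZagierPeriods.KontsevichZagierPeriods.Theorems.UnfoldedStokesStokesGenerationFibrewiseClosureMulFresh
import Summits.KontsevichZagierPeriods.KontsevichZagierPeriods.Theorems.UnfoldedStokesStokesGenerationFibrewiseClosureSum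
import Summits.KontsevichZagierPeriods.KontsevichZagierPeriods.Theorems.UnfoldedStokesStokesGenerationStubPlaceCoords

/-!
# `StokesGeneration` (stmt-KontsevichZagierPeriods-3586), line `fibrewise_stokes` — rung 11: the scaling certificate

Crux `Summit.KontsevichZagierPeriods.KontsevichZagierPeriods.Theses.UnfoldedStokes.StokesGeneration` (the kernel conjecture of the
Kontsevich–Zagier calculus); residual stub S2 `stub_fibrewiseStokesGeneration` (fibrewise Stokes generation on closed unit cubes,
`FibStokesDecomposable`, `Theorems/UnfoldedStokesDefs.lean`). This file proves the SCALING CERTIFICATE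
(`fibStokesDecomposable_scalingCore`): for a `ℚ`-semialgebraic `h` on `[0,1]^N`, continuous, independent of an idle coordinate
`b` and `C¹` along a coordinate `a ≠ b`, the difference `h(x) − h(x[a ↦ x_b])` (and `h(x) − h(x[a ↦ 1 − x_b])`) is
fibrewise-Stokes decomposable with TWO elements on the same cube — the Poincaré homotopy `s ↦ s · x_a`:
`G₀ = x_a h(x[a ↦ x_a x_b])` along `a`, `G₁ = x_b (h(x) − h(x[a ↦ x_a x_b]))` along `b`; no transcendence input, no value
hypothesis. Consequences (all transcendence-free): the transposition `k(x_a) − k(x_b)` and the reflection `k(x_a) − k(1 − x_a)`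
of an ARBITRARY semialgebraic `C¹` atom are decomposable (`fibStokesDecomposable_atomSwap`, `fibStokesDecomposable_atomRefl`;
this subsumes the exact/dlog/angular/rational transpositions of rungs 6, 9, 10d, 10e, which needed up to eleven elements),
and THEOREM D‴ (`fibStokesDecomposable_separated_of_dimOne`): a separated sum `Σᵢ kᵢ(x_{aᵢ})` is decomposable on `[0,1]^N` as
soon as `Σᵢ kᵢ` is decomposable on `[0,1]` — separated variables reduce to dimension one.

References: M. Kontsevich, D. Zagier, *Periods* (2001), §1.2 rules (2), (3) and Conjecture 1.
-/

noncomputable section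

set_option linter.dupNamespace false

namespace Summit.KontsevichZagierPeriods.KontsevichZagierPeriods.Cruxes.StokesGeneration.FibrewiseStokes

open MeasureTheory Set
open Literature.NumberTheory.Transcendental
open Literature.NumberTheory.Transcendental.KZ
open Literature.ModelTheory.ExponentialFields (IsSemialgebraic)

/-- Updating a coordinate of a point of the closed unit cube by a value of `[0,1]` stays in the cube. [folklore] -/
theorem update_mem_cubePi {N : ℕ} {x : Fin N → ℝ} (hx : x ∈ Set.pi Set.univ (fun _ : Fin N => Set.Icc (0:ℝ) 1))
    (i : Fin N) {s : ℝ} (hs : s ∈ Set.Icc (0:ℝ) 1) :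
    Function.update x i s ∈ Set.pi Set.univ (fun _ : Fin N => Set.Icc (0:ℝ) 1) :=
  Set.mem_univ_pi.mpr fun l => by
    rcases eq_or_ne l i with rfl | hli
    · simpa using hs
    · rw [Function.update_of_ne hli]; exact (Set.mem_univ_pi.mp hx) l

/-- The coordinate-update map `x ↦ x[i ↦ t]` with `t` algebraic is a `ℚ`-semialgebraic self-map of the closed unit
cube. [folklore] -/
theorem isSemialgebraicMapOn_update_const {N : ℕ} (i : Fin N) {t : ℝ} (ht : IsAlgebraic ℚ t) :
    IsSemialgebraicMapOn ℚ (Set.pi Set.univ (fun _ : Fin N => Set.Icc (0:ℝ) 1)) (fun x => Function.update x i t) := by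
  have hCsa : IsSemialgebraic ℚ (Set.pi Set.univ (fun _ : Fin N => Set.Icc (0:ℝ) 1)) := by
    rw [← cube_eq_pi]; exact isSemialgebraic_cube
  refine IsSemialgebraicMapOn.of_forall hCsa fun j => ?_
  rcases eq_or_ne j i with rfl | hji
  · exact (isSemialgebraicFunOn_const_of_isAlgebraic hCsa ht).congr fun x _ => by simp
  · exact (isSemialgebraicFunOn_apply hCsa j).congr fun x _ => by
      simp [Function.update_of_ne hji]

/-- **The scaling certificate (core form).** Let `h` be `ℚ`-semialgebraic and continuous on the closed unit cube
`[0,1]^N`, independent of the coordinate `b`, and `C¹` along the coordinate `a ≠ b` with a `ℚ`-semialgebraic continuous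
fibre derivative `hₐ` (also independent of `b`). Then for `φ(s) = s` (`ε = 1, c = 0`) or `φ(s) = 1 − s` (`ε = −1, c = 1`)
the difference `h(x) − h(x[a ↦ φ(x_b)])` — "move the live coordinate `a` onto the idle coordinate `b`" — is
fibrewise-Stokes decomposable, with TWO elements on the same cube and no transcendence input:
`G₀ = x_a · h(x[a ↦ x_a φ(x_b)])` along `a` and `G₁ = x_b · h(x) + (−εc − x_b) · h(x[a ↦ x_a φ(x_b)])` along `b`
(the Poincaré homotopy `s ↦ s·x_a`). [folklore; cite: KontsevichZagier2001, §1.2] -/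
theorem fibStokesDecomposable_scalingCore {N : ℕ} (a b : Fin N) (hab : a ≠ b) (ε c : ℝ)
    (hεc : (ε = 1 ∧ c = 0) ∨ (ε = -1 ∧ c = 1))
    (h hₐ : (Fin N → ℝ) → ℝ)
    (hh : IsSemialgebraicFunOn ℚ (Set.pi Set.univ (fun _ : Fin N => Set.Icc (0:ℝ) 1)) h)
    (hhₐ : IsSemialgebraicFunOn ℚ (Set.pi Set.univ (fun _ : Fin N => Set.Icc (0:ℝ) 1)) hₐ)
    (hhc : ContinuousOn h (Set.pi Set.univ (fun _ : Fin N => Set.Icc (0:ℝ) 1)))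
    (hhₐc : ContinuousOn hₐ (Set.pi Set.univ (fun _ : Fin N => Set.Icc (0:ℝ) 1)))
    (hb : ∀ x s, h (Function.update x b s) = h x) (hbₐ : ∀ x s, hₐ (Function.update x b s) = hₐ x)
    (hd : ∀ x ∈ Set.pi Set.univ (fun _ : Fin N => Set.Icc (0:ℝ) 1), x a ∈ Set.Ioo (0:ℝ) 1 →
      HasDerivAt (fun s => h (Function.update x a s)) (hₐ x) (x a)) :
    FibStokesDecomposable N (fun x => h x - h (Function.update x a (c + ε * x b))) := by
  classical
  set C : Set (Fin N → ℝ) := Set.pi Set.univ (fun _ : Fin N => Set.Icc (0:ℝ) 1) with hC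
  have hCsa : IsSemialgebraic ℚ C := by rw [hC, ← cube_eq_pi]; exact isSemialgebraic_cube
  have hCc : IsCompact C := isCompact_univ_pi fun _ => isCompact_Icc
  have hmem : ∀ x ∈ C, ∀ i, x i ∈ Set.Icc (0:ℝ) 1 := fun x hx i => (Set.mem_univ_pi.mp hx) i
  have hupd : ∀ x ∈ C, ∀ (i : Fin N), ∀ s ∈ Set.Icc (0:ℝ) 1, Function.update x i s ∈ C :=
    fun x hx i s hs => update_mem_cubePi hx i hs
  have hba : b ≠ a := fun h' => hab h'.symm
  -- arithmetic of `ε, c`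
  have hε2 : ε * ε = 1 := by rcases hεc with ⟨rfl, -⟩ | ⟨rfl, -⟩ <;> norm_num
  have hεalg : IsAlgebraic ℚ ε := by
    rcases hεc with ⟨rfl, -⟩ | ⟨rfl, -⟩
    exacts [isAlgebraic_one, isAlgebraic_one.neg]
  have hcalg : IsAlgebraic ℚ c := by
    rcases hεc with ⟨-, rfl⟩ | ⟨-, rfl⟩
    exacts [isAlgebraic_zero, isAlgebraic_one]
  have hφI : ∀ s ∈ Set.Icc (0:ℝ) 1, c + ε * s ∈ Set.Icc (0:ℝ) 1 := by
    intro s hs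
    rcases hεc with ⟨rfl, rfl⟩ | ⟨rfl, rfl⟩
    · simpa using hs
    · exact ⟨by nlinarith [hs.2], by nlinarith [hs.1]⟩
  have hφIoo : ∀ s ∈ Set.Ioo (0:ℝ) 1, c + ε * s ∈ Set.Ioo (0:ℝ) 1 := by
    intro s hs
    rcases hεc with ⟨rfl, rfl⟩ | ⟨rfl, rfl⟩
    · simpa using hs
    · exact ⟨by nlinarith [hs.2], by nlinarith [hs.1]⟩
  have hmulI : ∀ u ∈ Set.Icc (0:ℝ) 1, ∀ v ∈ Set.Icc (0:ℝ) 1, u * v ∈ Set.Icc (0:ℝ) 1 :=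
    fun u hu v hv => ⟨mul_nonneg hu.1 hv.1, by nlinarith [hu.1, hu.2, hv.1, hv.2]⟩
  -- the fibre derivative along `a`, at an arbitrary interior height `u₀`
  have hH : ∀ x ∈ C, ∀ u₀ ∈ Set.Ioo (0:ℝ) 1,
      HasDerivAt (fun u => h (Function.update x a u)) (hₐ (Function.update x a u₀)) u₀ := by
    intro x hx u₀ hu₀
    have hx' : Function.update x a u₀ ∈ C := hupd x hx a u₀ (Set.Ioo_subset_Icc_self hu₀)
    have := hd _ hx' (by simpa using hu₀)
    simpa [Function.update_idem] using this
  -- the scaled point `Sc x = x[a ↦ x_a φ(x_b)]`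
  obtain ⟨Sc, hSc⟩ : ∃ Sc : (Fin N → ℝ) → (Fin N → ℝ), Sc = fun x =>
      Function.update x a (x a * (c + ε * x b)) := ⟨_, rfl⟩
  have hScC : ∀ x ∈ C, Sc x ∈ C := fun x hx => by
    rw [hSc]; exact hupd x hx a _ (hmulI _ (hmem x hx a) _ (hφI _ (hmem x hx b)))
  have hSc_sa : IsSemialgebraicMapOn ℚ C Sc := by
    refine IsSemialgebraicMapOn.of_forall hCsa fun j => ?_
    rcases eq_or_ne j a with rfl | hja
    · have : IsSemialgebraicFunOn ℚ C (fun x => x j * (c + ε * x b)) :=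
        (isSemialgebraicFunOn_apply hCsa j).fun_mul
          ((isSemialgebraicFunOn_const_of_isAlgebraic hCsa hcalg).fun_add
            ((isSemialgebraicFunOn_const_of_isAlgebraic hCsa hεalg).fun_mul (isSemialgebraicFunOn_apply hCsa b)))
      exact this.congr fun x _ => by simp [hSc]
    · exact (isSemialgebraicFunOn_apply hCsa j).congr fun x _ => by simp [hSc, Function.update_of_ne hja]
  have hSc_cont : Continuous Sc := by
    rw [hSc]
    exact continuous_id.update a
      ((continuous_apply a).mul (continuous_const.add (continuous_const.mul (continuous_apply b))))
  have hhS : IsSemialgebraicFunOn ℚ C (fun x => h (Sc x)) :=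
    IsSemialgebraicFunOn.comp_isSemialgebraicMapOn_holds hh hSc_sa hScC
  have hhₐS : IsSemialgebraicFunOn ℚ C (fun x => hₐ (Sc x)) :=
    IsSemialgebraicFunOn.comp_isSemialgebraicMapOn_holds hhₐ hSc_sa hScC
  have hhSc : ContinuousOn (fun x => h (Sc x)) C := hhc.comp hSc_cont.continuousOn hScC
  have hhₐSc : ContinuousOn (fun x => hₐ (Sc x)) C := hhₐc.comp hSc_cont.continuousOn hScC
  -- semialgebraic atoms on `C`
  have hxa : IsSemialgebraicFunOn ℚ C (fun x => x a) := isSemialgebraicFunOn_apply hCsa a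
  have hxb : IsSemialgebraicFunOn ℚ C (fun x => x b) := isSemialgebraicFunOn_apply hCsa b
  have hcst : ∀ {t : ℝ}, IsAlgebraic ℚ t → IsSemialgebraicFunOn ℚ C (fun _ => t) := fun ht =>
    isSemialgebraicFunOn_const_of_isAlgebraic hCsa ht
  have hφsa : IsSemialgebraicFunOn ℚ C (fun x => x a * (c + ε * x b)) :=
    hxa.fun_mul ((hcst hcalg).fun_add ((hcst hεalg).fun_mul hxb))
  have hφc : Continuous (fun x : Fin N → ℝ => x a * (c + ε * x b)) :=
    (continuous_apply a).mul (continuous_const.add (continuous_const.mul (continuous_apply b)))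
  -- the witnesses
  obtain ⟨G0, hG0⟩ : ∃ G0 : (Fin N → ℝ) → ℝ, G0 = fun x => x a * h (Sc x) := ⟨_, rfl⟩
  obtain ⟨D0, hD0⟩ : ∃ D0 : (Fin N → ℝ) → ℝ, D0 = fun x => h (Sc x) + x a * (c + ε * x b) * hₐ (Sc x) := ⟨_, rfl⟩
  obtain ⟨G1, hG1⟩ : ∃ G1 : (Fin N → ℝ) → ℝ, G1 = fun x => x b * h x + (-(ε * c) - x b) * h (Sc x) := ⟨_, rfl⟩
  obtain ⟨D1, hD1⟩ : ∃ D1 : (Fin N → ℝ) → ℝ, D1 = fun x => h x - h (Sc x) - x a * (c + ε * x b) * hₐ (Sc x) :=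
    ⟨_, rfl⟩
  have hG0sa : IsSemialgebraicFunOn ℚ C G0 := by rw [hG0]; exact hxa.fun_mul hhS
  have hD0sa : IsSemialgebraicFunOn ℚ C D0 := by rw [hD0]; exact hhS.fun_add (hφsa.fun_mul hhₐS)
  have hG1sa : IsSemialgebraicFunOn ℚ C G1 := by
    rw [hG1]
    exact (hxb.fun_mul hh).fun_add ((((hcst hεalg).fun_mul (hcst hcalg)).fun_neg.fun_sub hxb).fun_mul hhS)
  have hD1sa : IsSemialgebraicFunOn ℚ C D1 := by rw [hD1]; exact (hh.fun_sub hhS).fun_sub (hφsa.fun_mul hhₐS)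
  have hG0c : ContinuousOn G0 C := by rw [hG0]; exact (continuous_apply a).continuousOn.mul hhSc
  have hD0c : ContinuousOn D0 C := by rw [hD0]; exact hhSc.add (hφc.continuousOn.mul hhₐSc)
  have hG1c : ContinuousOn G1 C := by
    rw [hG1]
    exact ((continuous_apply b).continuousOn.mul hhc).add
      ((continuous_const.sub (continuous_apply b)).continuousOn.mul hhSc)
  have hD1c : ContinuousOn D1 C := by rw [hD1]; exact (hhc.sub hhSc).sub (hφc.continuousOn.mul hhₐSc)
  -- composition with the (semialgebraic, continuous) face maps `x ↦ x[i ↦ t]`, `t ∈ {0, 1}`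
  have hface_sa : ∀ {F : (Fin N → ℝ) → ℝ}, IsSemialgebraicFunOn ℚ C F → ∀ (i : Fin N) (t : ℝ), IsAlgebraic ℚ t →
      t ∈ Set.Icc (0:ℝ) 1 → IsSemialgebraicFunOn ℚ C (fun x => F (Function.update x i t)) :=
    fun hF i t ht htI => IsSemialgebraicFunOn.comp_isSemialgebraicMapOn_holds hF
      (isSemialgebraicMapOn_update_const i ht) fun x hx => hupd x hx i t htI
  have hface_c : ∀ {F : (Fin N → ℝ) → ℝ}, ContinuousOn F C → ∀ (i : Fin N) (t : ℝ), t ∈ Set.Icc (0:ℝ) 1 →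
      ContinuousOn (fun x => F (Function.update x i t)) C :=
    fun hF i t htI => hF.comp (continuous_id.update i continuous_const).continuousOn fun x hx => hupd x hx i t htI
  have hcu : ∀ (x : Fin N → ℝ) (i : Fin N), Continuous fun s : ℝ => Function.update x i s :=
    fun x i => continuous_const.update i continuous_id
  have h0I : (0:ℝ) ∈ Set.Icc (0:ℝ) 1 := ⟨le_rfl, zero_le_one⟩
  have h1I : (1:ℝ) ∈ Set.Icc (0:ℝ) 1 := ⟨zero_le_one, le_rfl⟩
  -- the two integrands and their representations on the cube
  obtain ⟨I0, hI0⟩ : ∃ I0 : (Fin N → ℝ) → ℝ, I0 = fun x =>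
      D0 x - (G0 (Function.update x a 1) - G0 (Function.update x a 0)) := ⟨_, rfl⟩
  obtain ⟨I1, hI1⟩ : ∃ I1 : (Fin N → ℝ) → ℝ, I1 = fun x =>
      D1 x - (G1 (Function.update x b 1) - G1 (Function.update x b 0)) := ⟨_, rfl⟩
  have hI0sa : IsSemialgebraicFunOn ℚ C I0 := by
    rw [hI0]
    exact hD0sa.fun_sub ((hface_sa hG0sa a 1 isAlgebraic_one h1I).fun_sub (hface_sa hG0sa a 0 isAlgebraic_zero h0I))
  have hI1sa : IsSemialgebraicFunOn ℚ C I1 := by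
    rw [hI1]
    exact hD1sa.fun_sub ((hface_sa hG1sa b 1 isAlgebraic_one h1I).fun_sub (hface_sa hG1sa b 0 isAlgebraic_zero h0I))
  have hI0c : ContinuousOn I0 C := by
    rw [hI0]; exact hD0c.sub ((hface_c hG0c a 1 h1I).sub (hface_c hG0c a 0 h0I))
  have hI1c : ContinuousOn I1 C := by
    rw [hI1]; exact hD1c.sub ((hface_c hG1c b 1 h1I).sub (hface_c hG1c b 0 h0I))
  obtain ⟨q0, hq0d, hq0i⟩ := exists_cubeRep N I0 hI0sa hI0c
  obtain ⟨q1, hq1d, hq1i⟩ := exists_cubeRep N I1 hI1sa hI1c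
  -- bounds
  have hbound : ∀ {F : (Fin N → ℝ) → ℝ}, ContinuousOn F C → ∃ B : ℝ, ∀ x ∈ C, |F x| ≤ B := fun hF => by
    obtain ⟨B, hB⟩ := hCc.exists_bound_of_continuousOn hF
    exact ⟨B, fun x hx => by simpa [Real.norm_eq_abs] using hB x hx⟩
  -- useful pointwise identities
  have hSc_a : ∀ x s, Sc (Function.update x a s) = Function.update x a (s * (c + ε * x b)) := by
    intro x s; rw [hSc]; simp [Function.update_idem, Function.update_of_ne hba]
  have hSc_b : ∀ x s, h (Sc (Function.update x b s)) = h (Function.update x a (x a * (c + ε * s))) := by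
    intro x s
    rw [hSc]
    simp only [Function.update_self, Function.update_of_ne hab]
    rw [Function.update_comm hba, hb]
  have hSc_bₐ : ∀ x s, hₐ (Sc (Function.update x b s)) = hₐ (Function.update x a (x a * (c + ε * s))) := by
    intro x s
    rw [hSc]
    simp only [Function.update_self, Function.update_of_ne hab]
    rw [Function.update_comm hba, hbₐ]
  -- assemble the two elements
  have hdec : FibStokesDecomposable N (fun x => ∑ j, ((![q0, q1] : Fin 2 → IntegralRep N) j).integrand x) := by
    refine fibStokesDecomposable_of_elements (M := N) (J := 2) (![a, b] : Fin 2 → Fin N)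
      (![G0, G1] : Fin 2 → (Fin N → ℝ) → ℝ) (![D0, D1] : Fin 2 → (Fin N → ℝ) → ℝ)
      (![q0, q1] : Fin 2 → IntegralRep N) ?_ ?_
    · refine Fin.forall_fin_two.mpr ⟨?_, ?_⟩
      · -- element 0, along `a`
        simp only [Matrix.cons_val_zero]
        refine ⟨hG0sa, hD0sa, hbound hG0c, fun x hx => ?_, fun x hx hxa' => ?_⟩
        · -- fibre continuity
          show ContinuousOn (fun s : ℝ => G0 (Function.update x a s)) (Set.Icc (0:ℝ) 1)
          exact hG0c.comp (hcu x a).continuousOn fun s hs => hupd x hx a s hs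
        · -- fibre derivative
          show HasDerivAt (fun s : ℝ => G0 (Function.update x a s)) (D0 x) (x a)
          have hxaI : x a ∈ Set.Ioo (0:ℝ) 1 := by simpa using hxa'
          have hfun : (fun s : ℝ => G0 (Function.update x a s)) =
              fun s => s * h (Function.update x a (s * (c + ε * x b))) := by
            funext s; rw [hG0]; simp only [Function.update_self, hSc_a]
          rw [hfun, hD0]
          simp only
          rcases (hφI _ (hmem x hx b)).1.eq_or_lt with hφ0 | hφpos
          · -- `φ(x_b) = 0`: the fibre map is linear
            rw [← hφ0]
            simp only [mul_zero, zero_mul, add_zero]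
            have : Sc x = Function.update x a 0 := by rw [hSc]; simp [← hφ0]
            rw [this]
            simpa using (hasDerivAt_id' (x a)).mul_const (h (Function.update x a 0))
          · have hIoo : x a * (c + ε * x b) ∈ Set.Ioo (0:ℝ) 1 :=
              ⟨mul_pos hxaI.1 hφpos, by nlinarith [hxaI.2, (hφI _ (hmem x hx b)).2, hxaI.1]⟩
            have hin : HasDerivAt (fun s : ℝ => s * (c + ε * x b)) (c + ε * x b) (x a) := by
              simpa using (hasDerivAt_id' (x a)).mul_const (c + ε * x b)
            have hout := hH x hx _ hIoo
            have hcomp : HasDerivAt (fun s : ℝ => h (Function.update x a (s * (c + ε * x b))))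
                (hₐ (Function.update x a (x a * (c + ε * x b))) * (c + ε * x b)) (x a) :=
              HasDerivAt.comp (x a) (h₂ := fun u => h (Function.update x a u)) hout hin
            have hSx : Sc x = Function.update x a (x a * (c + ε * x b)) := by rw [hSc]
            rw [hSx]
            refine ((hasDerivAt_id' (x a)).mul hcomp).congr_deriv ?_
            ring
      · -- element 1, along `b`
        simp only [Matrix.cons_val_one, Matrix.cons_val_zero]
        refine ⟨hG1sa, hD1sa, hbound hG1c, fun x hx => ?_, fun x hx hxb' => ?_⟩
        · show ContinuousOn (fun s : ℝ => G1 (Function.update x b s)) (Set.Icc (0:ℝ) 1)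
          exact hG1c.comp (hcu x b).continuousOn fun s hs => hupd x hx b s hs
        · show HasDerivAt (fun s : ℝ => G1 (Function.update x b s)) (D1 x) (x b)
          have hxbI : x b ∈ Set.Ioo (0:ℝ) 1 := by simpa using hxb'
          have hfun : (fun s : ℝ => G1 (Function.update x b s)) =
              fun s => s * h x + (-(ε * c) - s) * h (Function.update x a (x a * (c + ε * s))) := by
            funext s; rw [hG1]; simp only [Function.update_self, hb, hSc_b]
          rw [hfun, hD1]
          simp only
          have hSx : Sc x = Function.update x a (x a * (c + ε * x b)) := by rw [hSc]
          rcases (hmem x hx a).1.eq_or_lt with ha0 | hapos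
          · -- `x_a = 0`: the fibre map is affine
            rw [hSx, ← ha0]
            simp only [zero_mul]
            have e1 := (hasDerivAt_id' (x b)).mul_const (h x)
            have hl : HasDerivAt (fun y : ℝ => -(ε * c) - y) (-1) (x b) := (hasDerivAt_id' (x b)).const_sub _
            have e2 := hl.mul_const (h (Function.update x a 0))
            refine (e1.add e2).congr_deriv ?_
            ring
          · have hIoo : ∀ s ∈ Set.Ioo (0:ℝ) 1, x a * (c + ε * s) ∈ Set.Ioo (0:ℝ) 1 := fun s hs =>
              ⟨mul_pos hapos (hφIoo s hs).1,
                by nlinarith [(hmem x hx a).2, (hφIoo s hs).2, (hφIoo s hs).1, hapos]⟩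
            have hin : HasDerivAt (fun s : ℝ => x a * (c + ε * s)) (x a * ε) (x b) := by
              have := ((hasDerivAt_id' (x b)).const_mul ε).const_add c
              simpa using this.const_mul (x a)
            have hout := hH x hx _ (hIoo _ hxbI)
            have hcomp : HasDerivAt (fun s : ℝ => h (Function.update x a (x a * (c + ε * s))))
                (hₐ (Function.update x a (x a * (c + ε * x b))) * (x a * ε)) (x b) :=
              HasDerivAt.comp (x b) (h₂ := fun u => h (Function.update x a u)) hout hin
            have e1 := (hasDerivAt_id' (x b)).mul_const (h x)
            have hl : HasDerivAt (fun y : ℝ => -(ε * c) - y) (-1) (x b) := (hasDerivAt_id' (x b)).const_sub _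
            have e2 := hl.mul hcomp
            rw [hSx]
            refine (e1.add e2).congr_deriv ?_
            linear_combination (-(x a * c * hₐ (Function.update x a (x a * (c + ε * x b))))) * hε2
    · refine Fin.forall_fin_two.mpr ⟨?_, ?_⟩
      · simp only [Matrix.cons_val_zero]
        exact ⟨hq0d, fun x _ => by rw [hq0i, hI0]⟩
      · simp only [Matrix.cons_val_one, Matrix.cons_val_zero]
        exact ⟨hq1d, fun x _ => by rw [hq1i, hI1]⟩
  -- the pointwise identity
  refine fibStokesDecomposable_congr_off_null N _ _ ∅
    Literature.ModelTheory.ExponentialFields.isSemialgebraic_empty measure_empty (fun x hx _ => ?_) hdec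
  have hface0 : G0 (Function.update x a 1) - G0 (Function.update x a 0) = h (Function.update x a (c + ε * x b)) := by
    rw [hG0]; simp only [Function.update_self, hSc_a]; simp
  have hface1 : G1 (Function.update x b 1) - G1 (Function.update x b 0) = 0 := by
    rw [hG1]
    simp only [Function.update_self, hb, hSc_b]
    rcases hεc with ⟨rfl, rfl⟩ | ⟨rfl, rfl⟩
    · simp
    · simp
  have hsum : D0 x + D1 x = h x := by rw [hD0, hD1]; simp only; ring
  simp only [Fin.sum_univ_two, Matrix.cons_val_zero, Matrix.cons_val_one, hq0i, hq1i, hI0, hI1,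
    hface0, hface1]
  linarith

end Summit.KontsevichZagierPeriods.KontsevichZagierPeriods.Cruxes.StokesGeneration.FibrewiseStokes

end
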